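import Summits.QuantumFields.YangMills.Theorems.UnitScaleTiltProp7CornerFrameLegsStepCell
import Summits.QuantumFields.YangMills.Theorems.UnitScaleTiltProp7CornerFrameLegsMassStep
import Summits.QuantumFields.YangMills.Theorems.UnitScaleTiltProp7CornerFrameLegsCurvature
import Summits.QuantumFields.YangMills.Theorems.UnitScaleTiltProp7CombTowerWindowsOfRegPrT3
import Summits.QuantumFields.YangMills.Theorems.UnitScaleTiltProp7CombFrameLinearResponseOfRegPrT3
import Summits.QuantumFields.YangMills.Theorems.UnitScaleTiltProp7CombPeriodCellDict
import Summits.QuantumFields.YangMills.Theorems.UnitScaleTiltProp7LandauCombDict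
import Summits.QuantumFields.YangMills.Theorems.UnitScaleTiltProp7CoverTwistedChart
import HarnessLib

/-!
# `UnitScaleTiltProp7RLegsCovLevel` — LANE II (R-LEGS), (K2-L): THE MEMBER's ONE-LEVEL STEPS OF THE CURVED CORNER-FRAME LEGS AT `RegPr` —
# `E_{l+1} ≤ 4L⁻¹E_l + pM·a_l²·M_l + 36L⁴·G_l + pN·a_l²·N_l`, `M_{l+1} ≤ 2L⁻³M_l + 18L²·N_l`, `E_0 = M_0 = 0`
# for the derivatives `D_l = D[v_l]·A` of ★routeR-w2's comb accumulated frames along ✓`fderiv_vcov_succ_apply_tsum_of_regPr`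
# (crux `MinimiserStabilityRegPr`, stmt-QuantumFields-19200, EX lane, hN06 LANE II supplier (R-LEGS); `--supports stmt-QuantumFields-19200 --as helper`, count-neutral)

Cell `ym3-torus` (HUMAN RULING D-0037: YM₃ on T³ is ladder rung R3 — NOT d = 4, NOT infinite volume, NOT a mass gap, NOT the Clay problem), width seat `ym-ust-20520-w4` (g12), pen of the
curved row `rlegs`.  THEOREMS ONLY (0 `def`, 0 `sorry`); nothing here claims (R-LEGS-cov), (QB), (QH1), (REC), `hN06`, EX or the crux.

THE POINT.  The abstract one-cell steps ✓`Prop7CornerFrameLegsStepCell.legs_step_cell_le` (summed over the coarse direction `μ`) and ✓`Prop7CornerFrameLegsMassStep.mass_step_cell_le` are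
instantiated at the member: `V := Ū♯ˡ = avgIter L W♯ l`, `T := Ū♯ˡ⁺¹` (lit `avgIter_succ`, `rfl`), `W♯ = pull (bgUnits F K W) x₀`; the letters `Y_l x κ := D[t ↦ Ũˡ(W♯, (eᵗ)♯)(x,κ)](0)·A`,
`D_l z := D[t ↦ v_l(W♯,(eᵗ)♯)(z)](0)·A` are carried with their defining equations (`hY`, `hD`); the recursion `hrec` IS ★routeR-w2 ✓`fderiv_vcov_succ_apply_tsum_of_regPr`; `U1`-values, the
level plaquette letter `a_l = 2(2ε₀(Lˡ(L^{K−n})⁻¹)²)` and its window are ★routeR-w1 ✓`Prop7CombTowerWindowsOfRegPr.level_data_of_regPr`; the curvature letters `δ ≤ 2La_l`, `δ₀ ≤ 1792L²a_l`,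
`δ₁ ≤ 1798L²a_l` are ✓`Prop7CornerFrameLegsCurvature`; periodicity of `Ū♯ˡ, Y_l, D_l` over the level-`l` torus is ✓F-8a `Prop7CombPeriodCellDict` + ✓`Prop7CoverTwistedChart.wrec_add_period`.

* §1 `isPeriodic_linTild_of`, `isPeriodic_linVcov_of` — the letters are `N_l`-periodic; `linVcov_zero_of` — `D_0 = 0`.
* §2 ★★ `legsMass_level_step_of_regPr` — `M_{l+1} ≤ 2L⁻³·M_l + 18L²·N_l`.
* §3 ★★★ `legs_level_step_of_regPr` — `E_{l+1} ≤ 4L⁻¹·E_l + 48L⁻³(1798L²)²·a_l²·M_l + 36L⁴·G_l + 432L²(1798L²)²·a_l²·N_l`.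
HONEST SCOPE.  Instantiation∕bookkeeping; the rows bounding `G_l, N_l` are ★routeR's and stay outside; nothing of the crux ∕ the gap is claimed.  Rung R3.

References: T. Bałaban, CMP 98 (1985) 17–51 [Balaban1985Averaging] ((43) p.24, (52)–(54) p.26, (58) p.27, (97) p.32, (110)–(112) p.34, (160)–(163) p.42); CMP 109 (1987) 249–301
[Balaban1987RG1] ((0.1)–(0.4) pp.251–253).
-/

set_option autoImplicit false

noncomputable section

open scoped BigOperators Matrix.Norms.L2Operator Matrix

namespace Summit.QuantumFields.YangMills.Theorems.Prop7RLegsCovLevel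

open Finset
open Literature.MathematicalPhysics.QuantumFieldTheory.Balaban1983to89
open Literature.MathematicalPhysics.QuantumFieldTheory.Balaban1983to89.T3ContinuumYM3Torus
open T3PrintedRegularMinimiser (RegPr)
open T3SectALandauChart (bgUnits)
open B7Prop1Explicit renaming Site → LSite
open B7Prop1Explicit (e hol U1 expUnit treeWord boxVec plaqWord bavg)
open B7Prop2Explicit (avgIter avgIter_succ rescale rescale_apply pdev le_pdev)
open B7Eq78Linearization (conjR)
open B7Prop3GeneralRotated (tsum)
open B7Eq92Concrete (vcov tildIter)
open B7Eq99Concrete (wrec wrec_eq_vcov)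
open B10Eq27TorusAxialLog (pull)
open B12Ineq417Flat (shiftCfg)
open T4TermwiseTorus (IsPeriodic)
open Summit.QuantumFields.YangMills.Theorems.Prop7SPrint (basePt)
open Summit.QuantumFields.YangMills.Theorems.Prop7CombTowerWindowsOfRegPr (level_data_of_regPr)
open Summit.QuantumFields.YangMills.Theorems.Prop7CombFrameLinearResponseOfRegPr (fderiv_vcov_succ_apply_tsum_of_regPr)
open Summit.QuantumFields.YangMills.Theorems.Prop7CombPeriodCellDict (isPeriodic_avgIter isPeriodic_tildIter_T3 sitesPerDir_T3_mul_pow shiftCfg_eq_of_isPeriodic)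
open Summit.QuantumFields.YangMills.Theorems.Prop7LandauCombDict (isPeriodic_pull)
open Summit.QuantumFields.YangMills.Theorems.Prop7CoverTwistedChart (wrec_add_period)
open Summit.QuantumFields.YangMills.Theorems.Prop7CornerFrameLegsCurvature (thinRect_le straight_sub_bavg_le boxRect_le)
open Summit.QuantumFields.YangMills.Theorems.Prop7CornerFrameLegsStepCell (legs_step_cell_le)
open Summit.QuantumFields.YangMills.Theorems.Prop7CornerFrameLegsMassStep (mass_step_cell_le)

variable (F : T3Family) {n K : ℕ}

/-! ## §1 The letters are periodic over the level torus; the zeroth frame derivative vanishes -/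

/-- the background comb tower `Ū♯ˡ` is `N_l`-periodic (`l ≤ m + K`). [cite: Balaban1985Averaging, (43) p.24; Balaban1987RG1, (0.1) p.251] -/
theorem isPeriodic_avgIter_pull (W : GaugeField (F.P K) 0 (Matrix.specialUnitaryGroup (Fin 2) ℂ)) {l : ℕ} (hl : l ≤ F.m + K) :
    IsPeriodic ((F.P K).sitesPerDir l) (avgIter (F.P K).L (pull (bgUnits F K W) (basePt F n K)) l) := by
  have h := isPeriodic_pull (bgUnits F K W) (basePt F n K)
  rw [← sitesPerDir_T3_mul_pow F K hl] at h
  exact isPeriodic_avgIter (F.P K).L ((F.P K).sitesPerDir l) l h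

/-- the single-bar linear tower `Y_l = D[Ũˡ]·A` is `N_l`-periodic (`l ≤ m + K`). [cite: Balaban1985Averaging, (69) p.29, (111) p.34] -/
theorem isPeriodic_linTild_of (W : GaugeField (F.P K) 0 (Matrix.specialUnitaryGroup (Fin 2) ℂ)) (A : PBond (F.P K) 0 → Matrix (Fin 2) (Fin 2) ℂ)
    (Y : ℕ → LSite (F.P K).d → Fin (F.P K).d → Matrix (Fin 2) (Fin 2) ℂ)
    (hY : ∀ l x κ, Y l x κ = fderiv ℂ (fun t : PBond (F.P K) 0 → Matrix (Fin 2) (Fin 2) ℂ =>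
      ((tildIter (F.P K).L (pull (bgUnits F K W) (basePt F n K)) (pull (fun b => expUnit (t b)) (basePt F n K)) l x κ : (Matrix (Fin 2) (Fin 2) ℂ)ˣ) :
        Matrix (Fin 2) (Fin 2) ℂ)) 0 A)
    {l : ℕ} (hl : l ≤ F.m + K) : IsPeriodic ((F.P K).sitesPerDir l) (Y l) := by
  intro x m
  funext κ
  rw [hY, hY]
  have hper : ∀ t : PBond (F.P K) 0 → Matrix (Fin 2) (Fin 2) ℂ,
      tildIter (F.P K).L (pull (bgUnits F K W) (basePt F n K)) (pull (fun b => expUnit (t b)) (basePt F n K)) l (x + (((F.P K).sitesPerDir l : ℕ) : ℤ) • m)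
        = tildIter (F.P K).L (pull (bgUnits F K W) (basePt F n K)) (pull (fun b => expUnit (t b)) (basePt F n K)) l x :=
    fun t => isPeriodic_tildIter_T3 F K (isPeriodic_pull (bgUnits F K W) (basePt F n K)) (isPeriodic_pull (fun b => expUnit (t b)) (basePt F n K)) hl x m
  have hfun : (fun t : PBond (F.P K) 0 → Matrix (Fin 2) (Fin 2) ℂ =>
      ((tildIter (F.P K).L (pull (bgUnits F K W) (basePt F n K)) (pull (fun b => expUnit (t b)) (basePt F n K)) l (x + (((F.P K).sitesPerDir l : ℕ) : ℤ) • m) κ :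
        (Matrix (Fin 2) (Fin 2) ℂ)ˣ) : Matrix (Fin 2) (Fin 2) ℂ))
      = fun t => ((tildIter (F.P K).L (pull (bgUnits F K W) (basePt F n K)) (pull (fun b => expUnit (t b)) (basePt F n K)) l x κ : (Matrix (Fin 2) (Fin 2) ℂ)ˣ) :
        Matrix (Fin 2) (Fin 2) ℂ) := by
    funext t; rw [hper t]
  rw [hfun]

/-- the comb accumulated frame derivative `D_l = D[v_l]·A` is `N_l`-periodic (`l ≤ m + K`; (85) `w_l = v_l`, lit ✓`wrec_eq_vcov`, and ✓`wrec_add_period`).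
[cite: Balaban1985Averaging, (85) p.31, (97)–(99) p.32] -/
theorem isPeriodic_linVcov_of (W : GaugeField (F.P K) 0 (Matrix.specialUnitaryGroup (Fin 2) ℂ)) (A : PBond (F.P K) 0 → Matrix (Fin 2) (Fin 2) ℂ)
    (D : ℕ → LSite (F.P K).d → Matrix (Fin 2) (Fin 2) ℂ)
    (hD : ∀ l z, D l z = fderiv ℂ (fun t : PBond (F.P K) 0 → Matrix (Fin 2) (Fin 2) ℂ =>
      ((vcov (F.P K).L (pull (bgUnits F K W) (basePt F n K)) (pull (fun b => expUnit (t b)) (basePt F n K)) l z : (Matrix (Fin 2) (Fin 2) ℂ)ˣ) : Matrix (Fin 2) (Fin 2) ℂ)) 0 A)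
    {l : ℕ} (hl : l ≤ F.m + K) : IsPeriodic ((F.P K).sitesPerDir l) (D l) := by
  intro z m
  rw [hD, hD]
  -- the shift `(N_l)•m` read as `L^l • (N_l • m')` is a period of the data (`N_0 = N_l·L^l`)
  have hsm : (((F.P K).L : ℤ) ^ l) • ((((F.P K).sitesPerDir l : ℕ) : ℤ) • m) = (((F.P K).sitesPerDir 0 : ℕ) : ℤ) • m := by
    rw [smul_smul, ← sitesPerDir_T3_mul_pow F K hl]; congr 1; push_cast; rw [show ((F.P K).L : ℤ) = (F.L : ℤ) from rfl]; ring
  have h₀ : shiftCfg ((((F.P K).L : ℤ) ^ l) • ((((F.P K).sitesPerDir l : ℕ) : ℤ) • m)) (pull (bgUnits F K W) (basePt F n K)) = pull (bgUnits F K W) (basePt F n K) := by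
    rw [hsm]; exact shiftCfg_eq_of_isPeriodic (isPeriodic_pull (bgUnits F K W) (basePt F n K)) m
  have hper : ∀ t : PBond (F.P K) 0 → Matrix (Fin 2) (Fin 2) ℂ,
      vcov (F.P K).L (pull (bgUnits F K W) (basePt F n K)) (pull (fun b => expUnit (t b)) (basePt F n K)) l (z + (((F.P K).sitesPerDir l : ℕ) : ℤ) • m)
        = vcov (F.P K).L (pull (bgUnits F K W) (basePt F n K)) (pull (fun b => expUnit (t b)) (basePt F n K)) l z := by
    intro t
    have h₁ : shiftCfg ((((F.P K).L : ℤ) ^ l) • ((((F.P K).sitesPerDir l : ℕ) : ℤ) • m)) (pull (fun b => expUnit (t b)) (basePt F n K)) = pull (fun b => expUnit (t b)) (basePt F n K) := by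
      rw [hsm]; exact shiftCfg_eq_of_isPeriodic (isPeriodic_pull (fun b => expUnit (t b)) (basePt F n K)) m
    rw [← wrec_eq_vcov]
    exact wrec_add_period (F.P K).L h₀ h₁ z
  have hfun : (fun t : PBond (F.P K) 0 → Matrix (Fin 2) (Fin 2) ℂ =>
      ((vcov (F.P K).L (pull (bgUnits F K W) (basePt F n K)) (pull (fun b => expUnit (t b)) (basePt F n K)) l (z + (((F.P K).sitesPerDir l : ℕ) : ℤ) • m) :
        (Matrix (Fin 2) (Fin 2) ℂ)ˣ) : Matrix (Fin 2) (Fin 2) ℂ))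
      = fun t => ((vcov (F.P K).L (pull (bgUnits F K W) (basePt F n K)) (pull (fun b => expUnit (t b)) (basePt F n K)) l z : (Matrix (Fin 2) (Fin 2) ℂ)ˣ) :
        Matrix (Fin 2) (Fin 2) ℂ) := by
    funext t; rw [hper t]
  rw [hfun]

/-- `D_0 = 0` (`v_0 = 1`, lit ✓`vcov_zero`). [cite: Balaban1985Averaging, (97) p.32] -/
theorem linVcov_zero_of (W : GaugeField (F.P K) 0 (Matrix.specialUnitaryGroup (Fin 2) ℂ)) (A : PBond (F.P K) 0 → Matrix (Fin 2) (Fin 2) ℂ)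
    (D : ℕ → LSite (F.P K).d → Matrix (Fin 2) (Fin 2) ℂ)
    (hD : ∀ l z, D l z = fderiv ℂ (fun t : PBond (F.P K) 0 → Matrix (Fin 2) (Fin 2) ℂ =>
      ((vcov (F.P K).L (pull (bgUnits F K W) (basePt F n K)) (pull (fun b => expUnit (t b)) (basePt F n K)) l z : (Matrix (Fin 2) (Fin 2) ℂ)ˣ) : Matrix (Fin 2) (Fin 2) ℂ)) 0 A)
    (z : LSite (F.P K).d) : D 0 z = 0 := by
  rw [hD]
  simp only [B7Eq92Concrete.vcov_zero, Units.val_one]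
  rw [fderiv_const_apply]; rfl

/-! ## §2 ★★ The legs-mass step at the member -/

/-- ★★ **(K2-L, mass) `M_{l+1} ≤ 2L⁻³·M_l + 18L²·N_l`** for `l + 1 ≤ K − n` at `RegPr F n K ε₀ W` in the window `10⁷L³ε₀ ≤ 1`:
`Σ_{z : Site (l+1)} ‖D_{l+1}(ẑ)‖² ≤ 2(L³)⁻¹·Σ_{x : Site l}‖D_l(x̂)‖² + 18L²·Σ_{x : Site l}Σ_κ‖Y_l(x̂,κ)‖²` (✓`mass_step_cell_le` on ★routeR-w2's recursion).
[cite: Balaban1985Averaging, (58) p.27, (97) p.32, (163) p.42; Balaban1987RG1, (0.3) p.252] -/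
theorem legsMass_level_step_of_regPr {ε₀ : ℝ} (hε₀ : 0 < ε₀) (hε : 10 ^ 7 * (F.L : ℝ) ^ 3 * ε₀ ≤ 1)
    (W : GaugeField (F.P K) 0 (Matrix.specialUnitaryGroup (Fin 2) ℂ)) (hreg : RegPr F n K ε₀ W) (A : PBond (F.P K) 0 → Matrix (Fin 2) (Fin 2) ℂ)
    (Y : ℕ → LSite (F.P K).d → Fin (F.P K).d → Matrix (Fin 2) (Fin 2) ℂ)
    (hY : ∀ l x κ, Y l x κ = fderiv ℂ (fun t : PBond (F.P K) 0 → Matrix (Fin 2) (Fin 2) ℂ =>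
      ((tildIter (F.P K).L (pull (bgUnits F K W) (basePt F n K)) (pull (fun b => expUnit (t b)) (basePt F n K)) l x κ : (Matrix (Fin 2) (Fin 2) ℂ)ˣ) :
        Matrix (Fin 2) (Fin 2) ℂ)) 0 A)
    (D : ℕ → LSite (F.P K).d → Matrix (Fin 2) (Fin 2) ℂ)
    (hD : ∀ l z, D l z = fderiv ℂ (fun t : PBond (F.P K) 0 → Matrix (Fin 2) (Fin 2) ℂ =>
      ((vcov (F.P K).L (pull (bgUnits F K W) (basePt F n K)) (pull (fun b => expUnit (t b)) (basePt F n K)) l z : (Matrix (Fin 2) (Fin 2) ℂ)ˣ) : Matrix (Fin 2) (Fin 2) ℂ)) 0 A)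
    {l : ℕ} (hl : l + 1 ≤ K - n) :
    ∑ z : Site (F.P K) (l + 1), ‖D (l + 1) (fun ν => ((z ν).val : ℤ))‖ ^ 2
      ≤ 2 * ((F.L : ℝ) ^ 3)⁻¹ * ∑ x : Site (F.P K) l, ‖D l (fun ν => ((x ν).val : ℤ))‖ ^ 2
        + 18 * (F.L : ℝ) ^ 2 * ∑ x : Site (F.P K) l, ∑ κ : Fin (F.P K).d, ‖Y l (fun ν => ((x ν).val : ℤ)) κ‖ ^ 2 := by
  have hlm : l + 1 ≤ (F.P K).m + (F.P K).K := by show l + 1 ≤ F.m + K; omega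
  obtain ⟨hV, -, -, -⟩ := level_data_of_regPr F hε₀ hε W hreg (Nat.le_of_succ_le hl)
  have hYl : Y l = fun x κ => fderiv ℂ (fun t : PBond (F.P K) 0 → Matrix (Fin 2) (Fin 2) ℂ =>
      ((tildIter (F.P K).L (pull (bgUnits F K W) (basePt F n K)) (pull (fun b => expUnit (t b)) (basePt F n K)) l x κ : (Matrix (Fin 2) (Fin 2) ℂ)ˣ) :
        Matrix (Fin 2) (Fin 2) ℂ)) 0 A := funext fun x => funext fun κ => hY l x κ
  have hrec : ∀ z : LSite (F.P K).d, D (l + 1) z = ((Fintype.card (Fin (F.P K).d → Fin (F.P K).L) : ℂ))⁻¹ • ∑ r : Fin (F.P K).d → Fin (F.P K).L,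
      (tsum (avgIter (F.P K).L (pull (bgUnits F K W) (basePt F n K)) l) (Y l) (((F.P K).L : ℤ) • z) (treeWord (boxVec (F.P K).L r))
        + conjR (hol (avgIter (F.P K).L (pull (bgUnits F K W) (basePt F n K)) l) (((F.P K).L : ℤ) • z) (treeWord (boxVec (F.P K).L r)))
          (D l (((F.P K).L : ℤ) • z + boxVec (F.P K).L r))) := by
    intro z
    rw [hD, fderiv_vcov_succ_apply_tsum_of_regPr hε₀ hε W hreg hl z A, hYl]
    refine congrArg _ (Finset.sum_congr rfl fun r _ => ?_)
    rw [hD]; rfl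
  have h := mass_step_cell_le hlm hV (Y l) (D l) (D (l + 1)) hrec
  have hd : (F.P K).d = 3 := rfl
  have hLL : ((F.P K).L : ℝ) = (F.L : ℝ) := rfl
  have c1 : (2 : ℝ) * ((((F.P K).L : ℝ)) ^ (F.P K).d)⁻¹ = 2 * ((F.L : ℝ) ^ 3)⁻¹ := by rw [hd, hLL]
  have c2 : (2 : ℝ) * ((((F.P K).d * (F.P K).L : ℕ)) : ℝ) ^ 2 = 18 * (F.L : ℝ) ^ 2 := by rw [hd]; push_cast; rw [hLL]; ring
  rw [c1, c2] at h
  exact h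

/-! ## §3 ★★★ The legs step at the member -/

/-- ★★★ **(K2-L, legs) `E_{l+1} ≤ 4L⁻¹·E_l + 48L⁻³(1798L²)²·a_l²·M_l + 36L⁴·G_l + 432L²(1798L²)²·a_l²·N_l`** for `l + 1 ≤ K − n` at `RegPr F n K ε₀ W` in the window `10⁷L³ε₀ ≤ 1`, with
`a_l = 2(2ε₀(Lˡ(L^{K−n})⁻¹)²)` (★routeR-w1's level plaquette letter), `E_l = Σ_μ Σ_{x : Site l} ‖D_l(x̂) − R(Ū♯ˡ(x̂,μ))D_l(x̂ + e_μ)‖²`, `M_l = Σ_x ‖D_l(x̂)‖²`,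
`G_l = Σ_μ Σ_x Σ_κ ‖Y_l(x̂,κ) − R(Ū♯ˡ(x̂,μ))Y_l(x̂+e_μ,κ)‖²`, `N_l = Σ_x Σ_κ ‖Y_l(x̂,κ)‖²` — ✓`legs_step_cell_le` summed over `μ`, the curvature letters of ✓`Prop7CornerFrameLegsCurvature` at `d = 3`
(`δ = 2La_l`, `δ₀ = 64·4·7·L²a_l`, `δ₁ = (6 + 1792)L²a_l`). [cite: Balaban1985Averaging, (52)–(54) p.26, (58) p.27, (97) p.32, (110)–(112) p.34, (160)–(163) p.42; Balaban1987RG1, (0.3) p.252] -/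
theorem legs_level_step_of_regPr {ε₀ : ℝ} (hε₀ : 0 < ε₀) (hε : 10 ^ 7 * (F.L : ℝ) ^ 3 * ε₀ ≤ 1)
    (W : GaugeField (F.P K) 0 (Matrix.specialUnitaryGroup (Fin 2) ℂ)) (hreg : RegPr F n K ε₀ W) (A : PBond (F.P K) 0 → Matrix (Fin 2) (Fin 2) ℂ)
    (Y : ℕ → LSite (F.P K).d → Fin (F.P K).d → Matrix (Fin 2) (Fin 2) ℂ)
    (hY : ∀ l x κ, Y l x κ = fderiv ℂ (fun t : PBond (F.P K) 0 → Matrix (Fin 2) (Fin 2) ℂ =>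
      ((tildIter (F.P K).L (pull (bgUnits F K W) (basePt F n K)) (pull (fun b => expUnit (t b)) (basePt F n K)) l x κ : (Matrix (Fin 2) (Fin 2) ℂ)ˣ) :
        Matrix (Fin 2) (Fin 2) ℂ)) 0 A)
    (D : ℕ → LSite (F.P K).d → Matrix (Fin 2) (Fin 2) ℂ)
    (hD : ∀ l z, D l z = fderiv ℂ (fun t : PBond (F.P K) 0 → Matrix (Fin 2) (Fin 2) ℂ =>
      ((vcov (F.P K).L (pull (bgUnits F K W) (basePt F n K)) (pull (fun b => expUnit (t b)) (basePt F n K)) l z : (Matrix (Fin 2) (Fin 2) ℂ)ˣ) : Matrix (Fin 2) (Fin 2) ℂ)) 0 A)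
    {l : ℕ} (hl : l + 1 ≤ K - n) :
    ∑ μ : Fin (F.P K).d, ∑ z : Site (F.P K) (l + 1),
        ‖D (l + 1) (fun ν => ((z ν).val : ℤ)) - conjR (avgIter (F.P K).L (pull (bgUnits F K W) (basePt F n K)) (l + 1) (fun ν => ((z ν).val : ℤ)) μ)
            (D (l + 1) ((fun ν => ((z ν).val : ℤ)) + e μ))‖ ^ 2
      ≤ 4 * (F.L : ℝ)⁻¹ * ∑ μ : Fin (F.P K).d, ∑ x : Site (F.P K) l,
            ‖D l (fun ν => ((x ν).val : ℤ)) - conjR (avgIter (F.P K).L (pull (bgUnits F K W) (basePt F n K)) l (fun ν => ((x ν).val : ℤ)) μ) (D l ((fun ν => ((x ν).val : ℤ)) + e μ))‖ ^ 2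
        + (48 * ((F.L : ℝ) ^ 3)⁻¹ * (1798 * (F.L : ℝ) ^ 2) ^ 2) * (2 * (2 * ε₀ * (((F.L : ℝ)) ^ l * (((F.L : ℝ)) ^ (K - n))⁻¹) ^ 2)) ^ 2
            * ∑ x : Site (F.P K) l, ‖D l (fun ν => ((x ν).val : ℤ))‖ ^ 2
        + 36 * (F.L : ℝ) ^ 4 * ∑ μ : Fin (F.P K).d, ∑ x : Site (F.P K) l, ∑ κ : Fin (F.P K).d,
            ‖Y l (fun ν => ((x ν).val : ℤ)) κ - conjR (avgIter (F.P K).L (pull (bgUnits F K W) (basePt F n K)) l (fun ν => ((x ν).val : ℤ)) μ) (Y l ((fun ν => ((x ν).val : ℤ)) + e μ) κ)‖ ^ 2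
        + (432 * (F.L : ℝ) ^ 2 * (1798 * (F.L : ℝ) ^ 2) ^ 2) * (2 * (2 * ε₀ * (((F.L : ℝ)) ^ l * (((F.L : ℝ)) ^ (K - n))⁻¹) ^ 2)) ^ 2
            * ∑ x : Site (F.P K) l, ∑ κ : Fin (F.P K).d, ‖Y l (fun ν => ((x ν).val : ℤ)) κ‖ ^ 2 := by
  have hlm : l + 1 ≤ (F.P K).m + (F.P K).K := by show l + 1 ≤ F.m + K; omega
  have hlm' : l ≤ F.m + K := by omega
  have hL1 : 1 ≤ (F.P K).L := le_trans (by norm_num) (F.P K).hL.2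
  obtain ⟨hV, ha0, hpdev, hale⟩ := level_data_of_regPr F hε₀ hε W hreg (Nat.le_of_succ_le hl)
  obtain ⟨hT, -, -, -⟩ := level_data_of_regPr F hε₀ hε W hreg hl
  -- the letters
  set U₀ := pull (bgUnits F K W) (basePt F n K) with hU₀
  set a : ℝ := 2 * (2 * ε₀ * ((((F.P K).L : ℝ)) ^ l * ((((F.P K).L : ℝ)) ^ (K - n))⁻¹) ^ 2) with ha
  have h44 : ∀ (x : LSite (F.P K).d) (κ κ' : Fin (F.P K).d), κ ≠ κ' →
      ‖((hol (avgIter (F.P K).L U₀ l) x (plaqWord κ κ') : (Matrix (Fin 2) (Fin 2) ℂ)ˣ) : Matrix (Fin 2) (Fin 2) ℂ) - 1‖ ≤ a :=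
    fun x κ κ' _ => (le_pdev hV x κ κ').trans hpdev.le
  have hL0 : (0 : ℝ) < ((F.P K).L : ℝ) := by exact_mod_cast lt_of_lt_of_le (by norm_num) (F.P K).hL.2
  have hsmall : 512 * ((F.P K).d + 1) * ((F.P K).d + 4) * ((F.P K).L : ℝ) ^ 2 * a ≤ 1 := by
    have hDpos : 0 < 1024 * (((F.P K).d : ℝ) + 1) * (((F.P K).d : ℝ) + 4) * ((F.P K).L : ℝ) ^ 2 := by positivity
    have h1 : 512 * (((F.P K).d : ℝ) + 1) * (((F.P K).d : ℝ) + 4) * ((F.P K).L : ℝ) ^ 2 * a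
        ≤ 512 * (((F.P K).d : ℝ) + 1) * (((F.P K).d : ℝ) + 4) * ((F.P K).L : ℝ) ^ 2 * (1 / (1024 * (((F.P K).d : ℝ) + 1) * (((F.P K).d : ℝ) + 4) * ((F.P K).L : ℝ) ^ 2)) :=
      mul_le_mul_of_nonneg_left hale (by positivity)
    have h2 : 512 * (((F.P K).d : ℝ) + 1) * (((F.P K).d : ℝ) + 4) * ((F.P K).L : ℝ) ^ 2 * (1 / (1024 * (((F.P K).d : ℝ) + 1) * (((F.P K).d : ℝ) + 4) * ((F.P K).L : ℝ) ^ 2))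
        = 1 / 2 := by
      field_simp; ring
    linarith
  -- `T = Ū♯ˡ⁺¹ = rescale L (bavg L Ū♯ˡ)` (lit `avgIter_succ`, `rfl`)
  have hT' : ∀ x κ, rescale (F.P K).L (bavg (F.P K).L (avgIter (F.P K).L U₀ l)) x κ ∈ U1 (Matrix (Fin 2) (Fin 2) ℂ) := hT
  -- periodicity
  have hVper := isPeriodic_avgIter_pull F (n := n) W hlm'
  have hYper := isPeriodic_linTild_of F W A Y hY hlm'
  have hDper := isPeriodic_linVcov_of F W A D hD hlm'
  -- the recursion
  have hYl : Y l = fun x κ => fderiv ℂ (fun t : PBond (F.P K) 0 → Matrix (Fin 2) (Fin 2) ℂ =>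
      ((tildIter (F.P K).L (pull (bgUnits F K W) (basePt F n K)) (pull (fun b => expUnit (t b)) (basePt F n K)) l x κ : (Matrix (Fin 2) (Fin 2) ℂ)ˣ) :
        Matrix (Fin 2) (Fin 2) ℂ)) 0 A := funext fun x => funext fun κ => hY l x κ
  have hrec : ∀ z : LSite (F.P K).d, D (l + 1) z = ((Fintype.card (Fin (F.P K).d → Fin (F.P K).L) : ℂ))⁻¹ • ∑ r : Fin (F.P K).d → Fin (F.P K).L,
      (tsum (avgIter (F.P K).L U₀ l) (Y l) (((F.P K).L : ℤ) • z) (treeWord (boxVec (F.P K).L r))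
        + conjR (hol (avgIter (F.P K).L U₀ l) (((F.P K).L : ℤ) • z) (treeWord (boxVec (F.P K).L r))) (D l (((F.P K).L : ℤ) • z + boxVec (F.P K).L r))) := by
    intro z
    rw [hD, fderiv_vcov_succ_apply_tsum_of_regPr hε₀ hε W hreg hl z A, hYl]
    refine congrArg _ (Finset.sum_congr rfl fun r _ => ?_)
    rw [hD]; rfl
  -- one coarse direction at a time
  have hμ : ∀ μ : Fin (F.P K).d,
      ∑ z : Site (F.P K) (l + 1), ‖D (l + 1) (fun ν => ((z ν).val : ℤ)) - conjR (avgIter (F.P K).L U₀ (l + 1) (fun ν => ((z ν).val : ℤ)) μ)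
          (D (l + 1) ((fun ν => ((z ν).val : ℤ)) + e μ))‖ ^ 2
        ≤ 4 * (((F.P K).L : ℝ) ^ 2 * (((F.P K).L : ℝ) ^ (F.P K).d)⁻¹) * ∑ x : Site (F.P K) l,
              ‖D l (fun ν => ((x ν).val : ℤ)) - conjR (avgIter (F.P K).L U₀ l (fun ν => ((x ν).val : ℤ)) μ) (D l ((fun ν => ((x ν).val : ℤ)) + e μ))‖ ^ 2
          + 16 * (((F.P K).L : ℝ) ^ (F.P K).d)⁻¹ * ((2 * (F.P K).d * ((F.P K).L : ℝ) ^ 2 + 64 * ((F.P K).d + 1) * ((F.P K).d + 4) * ((F.P K).L : ℝ) ^ 2) * a) ^ 2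
              * ∑ x : Site (F.P K) l, ‖D l (fun ν => ((x ν).val : ℤ))‖ ^ 2
          + 4 * ((F.P K).L : ℝ) ^ 2 * (((F.P K).d * (F.P K).L : ℕ) : ℝ) ^ 2
              * ∑ x : Site (F.P K) l, ∑ κ : Fin (F.P K).d, ‖Y l (fun ν => ((x ν).val : ℤ)) κ - conjR (avgIter (F.P K).L U₀ l (fun ν => ((x ν).val : ℤ)) μ) (Y l ((fun ν => ((x ν).val : ℤ)) + e μ) κ)‖ ^ 2
          + 16 * (((F.P K).d * (F.P K).L : ℕ) : ℝ) ^ 2 * ((((F.P K).d * (F.P K).L : ℕ) : ℝ) * (2 * ((F.P K).L : ℝ) * a) + 64 * ((F.P K).d + 1) * ((F.P K).d + 4) * ((F.P K).L : ℝ) ^ 2 * a) ^ 2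
              * ∑ x : Site (F.P K) l, ∑ κ : Fin (F.P K).d, ‖Y l (fun ν => ((x ν).val : ℤ)) κ‖ ^ 2 := by
    intro μ
    rw [avgIter_succ]
    exact legs_step_cell_le hlm hV hT' hVper (Y l) hYper (D l) (D (l + 1)) hDper hrec μ (by positivity) (by positivity)
      (fun z => straight_sub_bavg_le (F.P K).L hV ha0 h44 hL1 hsmall (fun ν => ((z ν).val : ℤ)) μ)
      (fun y κ => thinRect_le (F.P K).L hV ha0 h44 y κ μ)
      (fun z r => boxRect_le (F.P K).L hV ha0 h44 hL1 hsmall (fun ν => ((z ν).val : ℤ)) μ r)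
  -- sum over the coarse direction and read the numbers at `d = 3`
  have hsum := Finset.sum_le_sum fun μ (_ : μ ∈ (Finset.univ : Finset (Fin (F.P K).d))) => hμ μ
  refine hsum.trans (le_of_eq ?_)
  simp only [Finset.sum_add_distrib, ← Finset.mul_sum, Finset.sum_const, Finset.card_univ, Fintype.card_fin, nsmul_eq_mul]
  have hd : (F.P K).d = 3 := rfl
  have hLL : ((F.P K).L : ℝ) = (F.L : ℝ) := rfl
  -- isolate the four sums, then it is a scalar identity
  generalize (∑ μ : Fin (F.P K).d, ∑ x : Site (F.P K) l,
      ‖D l (fun ν => ((x ν).val : ℤ)) - conjR (avgIter (F.P K).L U₀ l (fun ν => ((x ν).val : ℤ)) μ) (D l ((fun ν => ((x ν).val : ℤ)) + e μ))‖ ^ 2) = SE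
  generalize (∑ x : Site (F.P K) l, ‖D l (fun ν => ((x ν).val : ℤ))‖ ^ 2) = SM
  generalize (∑ μ : Fin (F.P K).d, ∑ x : Site (F.P K) l, ∑ κ : Fin (F.P K).d,
      ‖Y l (fun ν => ((x ν).val : ℤ)) κ - conjR (avgIter (F.P K).L U₀ l (fun ν => ((x ν).val : ℤ)) μ) (Y l ((fun ν => ((x ν).val : ℤ)) + e μ) κ)‖ ^ 2) = SG
  generalize (∑ x : Site (F.P K) l, ∑ κ : Fin (F.P K).d, ‖Y l (fun ν => ((x ν).val : ℤ)) κ‖ ^ 2) = SN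
  rw [ha, hd]
  push_cast
  rw [hLL]
  have hF0 : (F.L : ℝ) ≠ 0 := by rw [← hLL]; exact hL0.ne'
  field_simp
  ring

end Summit.QuantumFields.YangMills.Theorems.Prop7RLegsCovLevel

end
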